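import Summits.QuantumFields.BalabanUV.T4Continuum.Support.NE7NearFlatSharpPrep
import HarnessLib

/-!
# NE7NearFlatSharpHolonomyPrep — THE ALMOST-COMMUTING PAIR behind the nonlinear witness: `h₀ = D(z) = 1 + (z−1)E_{i₀i₀}` and `h₁ = 1 + (w−1)·P`,
# `P` = the rank-one projection onto `(e_{i₀} + e_{i₁})∕√2`; their commutator is `≤ 2|z−1||w−1|`, but EVERY COMMUTING pair `(g₀, g₁)` entrywise within `ε`
# of `(h₀, h₁)` has `(|w−1|∕2 − ε)(|z−1| − 2ε) ≤ 2(|n|−1)ε²` — so `ε ≳ min(|z−1|, |w−1|)`, the SQUARE ROOT of the commutator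

Cell `pub-balaban`, rung (B)+1 sub-cell t4, lineage `b2b-balaban-t4-ne7b-p1` (row NE7b OWNER + CRUX PROVER), generation 157; junction census for the NE7 road's
located gap (G2) of `t4/b2b-balaban-t4-ne7-p1-g113/ROAD-G113.md` §6 («class radius linear in the datum radius … explicit δ_V via gen 26's
`TorusSmallFieldGlobalGauge` would make δ_V explicit and linear in ε»; located at F29 `NE7SoftDataPath.exists_flat_near`).  Part 3a (matrix algebra); part 3b
`NE7NearFlatSharpHolonomy` builds the lattice datum whose two axis holonomies are `h₀, h₁` and reads the consequence through part 1's
`exists_commuting_pair_near_axisHol`.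
WHAT ([folklore]; 0 def, 0 sorry; `P`, `h₁` enter through EQUATIONAL HYPOTHESES `hχ`, `hP`, `hh`).  §1 **`entry_ineq_of_commuting_near`** — THE `(i₁, i₀)` ENTRY
OF `[g₀, g₁] = 0`: if `h₀` has row `i₁` and column `i₀` supported on the diagonal, `h₁` has row `i₁` and column `i₀` supported on `{i₀, i₁}` with
`(h₁)_{i₀i₀} = (h₁)_{i₁i₁}`, and `g₀ g₁ = g₁ g₀` with `|(g_μ − h_μ)_{ab}| ≤ ε` for all entries, then
`(|(h₁)_{i₁i₀}| − ε)·(|(h₀)_{i₀i₀} − (h₀)_{i₁i₁}| − 2ε) ≤ 2(card n − 1)ε²` (the `k ∈ {i₀, i₁}` terms give `r(d − a) + c(p − s)`, the others are `O(ε²)` each);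
`le_of_sq_entry_ineq` — the solved form `σ ≤ 2(1 + √(card n − 1))·ε` when `|(h₁)_{i₁i₀}| = σ∕2`, `|(h₀)_{i₀i₀} − (h₀)_{i₁i₁}| = σ`; §2 the block projection
`P_{ab} = χ_a χ_b ∕ 2` (`χ` = indicator of `{i₀, i₁}`): `sum_chi`, `proj_idem_selfAdjoint` (`P² = P`, `Pᴴ = P`), `norm_proj_le_one` (C⋆-identity),
the entries of `P`; §3 the unitary `h₁ = 1 + (w − 1)P` (`|w| = 1`): `hOne_mem_unitary`, `norm_hOne_sub_one_le` (`≤ |w − 1|`), its entries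
(`hOne_entries`: `(h₁)_{i₁i₀} = (w−1)∕2`, `(h₁)_{i₀i₀} = (h₁)_{i₁i₁}`, row `i₁`∕column `i₀` vanish off `{i₀,i₁}`); `phaseMat_entries` (the same for `D(z)`).
HONEST FRAMING (page 1): elementary matrix algebra; nothing of Bałaban's asserted; F29 and the road's ENDs untouched; NE3∕NE7 NOT proved; row NE7b
(`T4WeightBudget.RelWeightBound`) NOT PRINTED ∕ NOT PROVED; spine count = dagwriter's call; finite T⁴ rung (B)+1 — NOT infinite volume, NOT mass gap, NOT
BetaPertH, NOT Clay (continuum YM on T⁴ ⇐ BetaPertH ∧ nine spine estimates).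
-/

set_option autoImplicit false

open scoped BigOperators Matrix Matrix.Norms.L2Operator ComplexConjugate
open Finset NormedSpace Complex

namespace Summit.QuantumFields.BalabanUV.T4Continuum.NE7NearFlatSharpHolonomyPrep

open Literature.MathematicalPhysics.QuantumFieldTheory.Balaban1983to89
open B7Prop1Explicit B7Prop2Explicit
open TorusSmallFieldGlobalGaugeSharpPrep

noncomputable section

variable {n : Type*} [Fintype n] [DecidableEq n]

/-! ## §1 The `(i₁, i₀)` entry of `[g₀, g₁] = 0` for a commuting pair entrywise near `(h₀, h₁)` -/

section Entry

/-- **THE ENTRY INEQUALITY.**  Let `i₀ ≠ i₁`; let `h₀` have row `i₁` and column `i₀` supported on the diagonal, `h₁` have row `i₁` and column `i₀` supported on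
`{i₀, i₁}` with equal diagonal entries `(h₁)_{i₀i₀} = (h₁)_{i₁i₁}`; let `g₀ g₁ = g₁ g₀` with `|(g₀ − h₀)_{ab}|, |(g₁ − h₁)_{ab}| ≤ ε` for all `a, b`.  Then
`(|(h₁)_{i₁i₀}| − ε)·(|(h₀)_{i₀i₀} − (h₀)_{i₁i₁}| − 2ε) ≤ 2(card n − 1)·ε²`.  Proof: the `(i₁, i₀)` entry of `g₀g₁ − g₁g₀` is
`r(d − a) + c(p − s) + Σ_{k ∉ {i₀,i₁}} (…)` with `r = (g₁)_{i₁i₀}`, `a = (g₀)_{i₀i₀}`, `d = (g₀)_{i₁i₁}`, `c = (g₀)_{i₁i₀}` (`|c| ≤ ε`), `p − s = (g₁)_{i₀i₀} − (g₁)_{i₁i₁}`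
(`≤ 2ε`), each remaining term `≤ 2ε²`. [folklore] -/
theorem entry_ineq_of_commuting_near {i₀ i₁ : n} (h01 : i₀ ≠ i₁) {g₀ g₁ h₀ h₁ : Matrix n n ℂ} {ε : ℝ} (hε : 0 ≤ ε) (hc : g₀ * g₁ = g₁ * g₀)
    (hE0 : ∀ a b, ‖(g₀ - h₀) a b‖ ≤ ε) (hE1 : ∀ a b, ‖(g₁ - h₁) a b‖ ≤ ε)
    (hr0 : ∀ k, k ≠ i₁ → h₀ i₁ k = 0) (hc0 : ∀ k, k ≠ i₀ → h₀ k i₀ = 0)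
    (hr1 : ∀ k, k ≠ i₀ → k ≠ i₁ → h₁ i₁ k = 0) (hc1 : ∀ k, k ≠ i₀ → k ≠ i₁ → h₁ k i₀ = 0) (hd1 : h₁ i₀ i₀ = h₁ i₁ i₁) :
    (‖h₁ i₁ i₀‖ - ε) * (‖h₀ i₀ i₀ - h₀ i₁ i₁‖ - 2 * ε) ≤ 2 * ((Fintype.card n : ℝ) - 1) * ε ^ 2 := by
  -- the entry identity
  set f : n → ℂ := fun k => g₀ i₁ k * g₁ k i₀ - g₁ i₁ k * g₀ k i₀ with hf
  have hsum : ∑ k, f k = 0 := by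
    have h := congr_fun (congr_fun hc i₁) i₀
    simp only [Matrix.mul_apply] at h
    simp only [hf, Finset.sum_sub_distrib, h, sub_self]
  -- split off `k = i₀` and `k = i₁`
  set T : Finset n := (Finset.univ.erase i₀).erase i₁ with hT
  have hi₁ : i₁ ∈ Finset.univ.erase i₀ := Finset.mem_erase.mpr ⟨h01.symm, Finset.mem_univ _⟩
  have hsplit : ∑ k, f k = f i₀ + (f i₁ + ∑ k ∈ T, f k) := by
    rw [← Finset.add_sum_erase _ _ (Finset.mem_univ i₀), ← Finset.add_sum_erase _ _ hi₁]
  have hTcard : (T.card : ℝ) = (Fintype.card n : ℝ) - 2 := by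
    have h1 : T.card = Fintype.card n - 2 := by
      rw [hT, Finset.card_erase_of_mem hi₁, Finset.card_erase_of_mem (Finset.mem_univ _), Finset.card_univ]; omega
    have h2 : 2 ≤ Fintype.card n := by
      have : ({i₀, i₁} : Finset n).card ≤ Fintype.card n := Finset.card_le_univ _
      rwa [Finset.card_pair h01] at this
    rw [h1, Nat.cast_sub h2]; norm_num
  -- entrywise sizes
  have habs : ∀ (g h : Matrix n n ℂ) (a b : n), (∀ a b, ‖(g - h) a b‖ ≤ ε) → h a b = 0 → ‖g a b‖ ≤ ε := by
    intro g h a b hgh hz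
    have := hgh a b
    rwa [Matrix.sub_apply, hz, sub_zero] at this
  have hT_bound : ∀ k ∈ T, ‖f k‖ ≤ 2 * ε ^ 2 := by
    intro k hk
    have hk1 : k ≠ i₁ := (Finset.mem_erase.mp hk).1
    have hk0 : k ≠ i₀ := (Finset.mem_erase.mp (Finset.mem_erase.mp hk).2).1
    have b1 : ‖g₀ i₁ k‖ ≤ ε := habs g₀ h₀ i₁ k hE0 (hr0 k hk1)
    have b2 : ‖g₁ k i₀‖ ≤ ε := habs g₁ h₁ k i₀ hE1 (hc1 k hk0 hk1)
    have b3 : ‖g₁ i₁ k‖ ≤ ε := habs g₁ h₁ i₁ k hE1 (hr1 k hk0 hk1)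
    have b4 : ‖g₀ k i₀‖ ≤ ε := habs g₀ h₀ k i₀ hE0 (hc0 k hk0)
    calc ‖f k‖ ≤ ‖g₀ i₁ k * g₁ k i₀‖ + ‖g₁ i₁ k * g₀ k i₀‖ := norm_sub_le _ _
      _ ≤ ε * ε + ε * ε := by
          rw [norm_mul, norm_mul]
          exact add_le_add (mul_le_mul b1 b2 (norm_nonneg _) hε) (mul_le_mul b3 b4 (norm_nonneg _) hε)
      _ = 2 * ε ^ 2 := by ring
  have hrest : ‖∑ k ∈ T, f k‖ ≤ 2 * ((Fintype.card n : ℝ) - 2) * ε ^ 2 := by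
    calc ‖∑ k ∈ T, f k‖ ≤ ∑ k ∈ T, ‖f k‖ := norm_sum_le _ _
      _ ≤ ∑ k ∈ T, 2 * ε ^ 2 := Finset.sum_le_sum hT_bound
      _ = 2 * ((Fintype.card n : ℝ) - 2) * ε ^ 2 := by rw [Finset.sum_const, nsmul_eq_mul, hTcard]; ring
  -- the two principal terms: `f i₀ + f i₁ = r (d − a) + c (p − s)`
  set r := g₁ i₁ i₀ with hr
  set a := g₀ i₀ i₀ with ha
  set d := g₀ i₁ i₁ with hd
  set c := g₀ i₁ i₀ with hcc
  set p := g₁ i₀ i₀ with hp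
  set s := g₁ i₁ i₁ with hs
  have hprin : f i₀ + f i₁ = r * (d - a) + c * (p - s) := by
    simp only [hf, hr, ha, hd, hcc, hp, hs]; ring
  have hmain : ‖r * (d - a)‖ ≤ 2 * ((Fintype.card n : ℝ) - 1) * ε ^ 2 := by
    have e1 : r * (d - a) = -(c * (p - s)) - ∑ k ∈ T, f k := by
      have h0 : f i₀ + (f i₁ + ∑ k ∈ T, f k) = 0 := by rw [← hsplit]; exact hsum
      rw [← add_assoc, hprin] at h0
      linear_combination h0
    have hcε : ‖c‖ ≤ ε := habs g₀ h₀ i₁ i₀ hE0 (hr0 i₀ h01)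
    have hps : ‖p - s‖ ≤ 2 * ε := by
      have e2 : p - s = (g₁ - h₁) i₀ i₀ - (g₁ - h₁) i₁ i₁ := by
        simp only [Matrix.sub_apply, hp, hs, hd1]; ring
      rw [e2]
      exact (norm_sub_le _ _).trans (by linarith [hE1 i₀ i₀, hE1 i₁ i₁])
    rw [e1]
    calc ‖-(c * (p - s)) - ∑ k ∈ T, f k‖ ≤ ‖-(c * (p - s))‖ + ‖∑ k ∈ T, f k‖ := norm_sub_le _ _
      _ ≤ ε * (2 * ε) + 2 * ((Fintype.card n : ℝ) - 2) * ε ^ 2 := by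
          rw [norm_neg, norm_mul]
          exact add_le_add (mul_le_mul hcε hps (norm_nonneg _) hε) hrest
      _ = 2 * ((Fintype.card n : ℝ) - 1) * ε ^ 2 := by ring
  -- lower bounds on `|r|` and `|d − a|`
  have hrlow : ‖h₁ i₁ i₀‖ - ε ≤ ‖r‖ := by
    have := hE1 i₁ i₀
    rw [Matrix.sub_apply] at this
    have h2 := norm_sub_norm_le (h₁ i₁ i₀) r
    rw [← norm_neg (h₁ i₁ i₀ - r), neg_sub] at h2
    linarith
  have hdalow : ‖h₀ i₀ i₀ - h₀ i₁ i₁‖ - 2 * ε ≤ ‖d - a‖ := by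
    have h1 := hE0 i₀ i₀
    have h2 := hE0 i₁ i₁
    rw [Matrix.sub_apply] at h1 h2
    have h3 := norm_sub_norm_le (h₀ i₀ i₀ - h₀ i₁ i₁) (a - d)
    have e : h₀ i₀ i₀ - h₀ i₁ i₁ - (a - d) = (d - h₀ i₁ i₁) - (a - h₀ i₀ i₀) := by ring
    rw [e] at h3
    have h4 := (norm_sub_le (d - h₀ i₁ i₁) (a - h₀ i₀ i₀))
    rw [← ha, ← hd] at *
    rw [norm_sub_rev d a] at *
    linarith
  -- the four sign cases
  have hR : 0 ≤ 2 * ((Fintype.card n : ℝ) - 1) * ε ^ 2 := by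
    have h2 : (2 : ℝ) ≤ Fintype.card n := by
      have : ({i₀, i₁} : Finset n).card ≤ Fintype.card n := Finset.card_le_univ _
      rw [Finset.card_pair h01] at this
      exact_mod_cast this
    have : 0 ≤ (Fintype.card n : ℝ) - 1 := by linarith
    positivity
  have hprod : ‖r‖ * ‖d - a‖ ≤ 2 * ((Fintype.card n : ℝ) - 1) * ε ^ 2 := by rw [← norm_mul]; exact hmain
  rcases le_or_gt 0 (‖h₁ i₁ i₀‖ - ε) with hA | hA
  · rcases le_or_gt 0 (‖h₀ i₀ i₀ - h₀ i₁ i₁‖ - 2 * ε) with hB | hB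
    · exact (mul_le_mul hrlow hdalow hB (norm_nonneg _)).trans hprod
    · exact (mul_nonpos_of_nonneg_of_nonpos hA hB.le).trans hR
  · rcases le_or_gt 0 (‖h₀ i₀ i₀ - h₀ i₁ i₁‖ - 2 * ε) with hB | hB
    · exact (mul_nonpos_of_nonpos_of_nonneg hA.le hB).trans hR
    · -- both negative: the product is at most `ε · 2ε`
      have h2 : (2 : ℝ) ≤ Fintype.card n := by
        have : ({i₀, i₁} : Finset n).card ≤ Fintype.card n := Finset.card_le_univ _
        rw [Finset.card_pair h01] at this
        exact_mod_cast this
      nlinarith [norm_nonneg (h₁ i₁ i₀), norm_nonneg (h₀ i₀ i₀ - h₀ i₁ i₁)]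

omit [DecidableEq n] in
/-- **THE SOLVED FORM**: if `|(h₁)_{i₁i₀}| = σ∕2` and `|(h₀)_{i₀i₀} − (h₀)_{i₁i₁}| = σ` then the entry inequality `(σ∕2 − ε)(σ − 2ε) ≤ 2(card n − 1)ε²` forces
`σ ≤ 2(1 + √(card n − 1))·ε` — LINEAR in `ε`, although the commutator of `(h₀, h₁)` is quadratic in `σ`. [folklore] -/
theorem le_of_sq_entry_ineq {σ ε : ℝ} (hε : 0 ≤ ε) (hcard : 1 ≤ (Fintype.card n : ℝ))
    (h : (σ / 2 - ε) * (σ - 2 * ε) ≤ 2 * ((Fintype.card n : ℝ) - 1) * ε ^ 2) :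
    σ ≤ 2 * (1 + Real.sqrt ((Fintype.card n : ℝ) - 1)) * ε := by
  set q : ℝ := Real.sqrt ((Fintype.card n : ℝ) - 1) with hq
  have hq0 : 0 ≤ q := Real.sqrt_nonneg _
  have hqq : q * q = (Fintype.card n : ℝ) - 1 := Real.mul_self_sqrt (by linarith)
  have hsq : (σ - 2 * ε) ^ 2 ≤ (2 * q * ε) ^ 2 := by nlinarith
  rcases le_or_gt (σ - 2 * ε) 0 with hle | hgt
  · nlinarith
  · by_contra hcon
    push Not at hcon
    have hqε : 0 ≤ q * ε := mul_nonneg hq0 hε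
    nlinarith [mul_pos (by linarith : 0 < σ - 2 * ε - 2 * q * ε) (by linarith : 0 < σ - 2 * ε + 2 * q * ε)]

end Entry

/-! ## §2 The block projection `P_{ab} = χ_a χ_b ∕ 2`, `χ` the indicator of `{i₀, i₁}` -/

section Proj

variable {i₀ i₁ : n} (h01 : i₀ ≠ i₁) {χ : n → ℂ} (hχ : ∀ a, χ a = if a = i₀ ∨ a = i₁ then 1 else 0) {P : Matrix n n ℂ}
  (hP : ∀ a b, P a b = χ a * χ b / 2)
include hχ hP

omit [Fintype n] hP in
/-- `χ² = χ`, `χ̄ = χ`. [folklore] -/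
theorem chi_mul_self (a : n) : χ a * χ a = χ a ∧ conj (χ a) = χ a := by
  rw [hχ]; split_ifs <;> simp

include h01 in
omit hP in
/-- `Σ_k χ_k = 2`. [folklore] -/
theorem sum_chi : ∑ k, χ k = 2 := by
  have e : ∀ k, χ k = (if k = i₀ then (1 : ℂ) else 0) + (if k = i₁ then 1 else 0) := by
    intro k
    rw [hχ]
    by_cases h0 : k = i₀
    · subst h0; simp [h01]
    · by_cases h1 : k = i₁
      · subst h1; simp [h0]
      · simp [h0, h1]
  simp_rw [e]
  rw [Finset.sum_add_distrib, Finset.sum_ite_eq' Finset.univ i₀, Finset.sum_ite_eq' Finset.univ i₁]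
  simp only [Finset.mem_univ, if_true]
  norm_num

include h01 in
/-- `P² = P` and `Pᴴ = P`: `P` is the orthogonal projection onto `(e_{i₀} + e_{i₁})∕√2`. [folklore] -/
theorem proj_idem_selfAdjoint : P * P = P ∧ Pᴴ = P := by
  constructor
  · ext a b
    rw [Matrix.mul_apply]
    have e : ∀ k, P a k * P k b = (χ a * χ b / 4) * χ k := by
      intro k
      have hk := (chi_mul_self hχ k).1
      rw [hP, hP]
      linear_combination (χ a * χ b / 4) * hk
    simp_rw [e]
    rw [← Finset.mul_sum, sum_chi h01 hχ, hP]
    ring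
  · ext a b
    rw [Matrix.conjTranspose_apply, hP, hP, Complex.star_def, map_div₀, map_mul, (chi_mul_self hχ a).2, (chi_mul_self hχ b).2, map_ofNat,
      mul_comm]

include h01 in
/-- `‖P‖ ≤ 1` (C⋆-identity: `‖P‖² = ‖PᴴP‖ = ‖P‖`). [folklore] -/
theorem norm_proj_le_one : ‖P‖ ≤ 1 := by
  have h1 : ‖star P * P‖ = ‖P‖ * ‖P‖ := CStarRing.norm_star_mul_self
  rw [Matrix.star_eq_conjTranspose, (proj_idem_selfAdjoint h01 hχ hP).2, (proj_idem_selfAdjoint h01 hχ hP).1] at h1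
  nlinarith [norm_nonneg P]

omit [Fintype n] in
/-- The entries of `P` on the block and off it. [folklore] -/
theorem proj_apply_block : P i₁ i₀ = 1 / 2 ∧ P i₀ i₀ = 1 / 2 ∧ P i₁ i₁ = 1 / 2 ∧
    (∀ k, k ≠ i₀ → k ≠ i₁ → P i₁ k = 0) ∧ (∀ k, k ≠ i₀ → k ≠ i₁ → P k i₀ = 0) := by
  have h0 : χ i₀ = 1 := by rw [hχ]; simp
  have h1 : χ i₁ = 1 := by rw [hχ]; simp
  have hk : ∀ k, k ≠ i₀ → k ≠ i₁ → χ k = 0 := fun k hk0 hk1 => by rw [hχ]; simp [hk0, hk1]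
  refine ⟨?_, ?_, ?_, fun k hk0 hk1 => ?_, fun k hk0 hk1 => ?_⟩
  · rw [hP, h1, h0]; norm_num
  · rw [hP, h0]; norm_num
  · rw [hP, h1]; norm_num
  · rw [hP, hk k hk0 hk1]; simp
  · rw [hP, hk k hk0 hk1]; simp

end Proj

/-! ## §3 The unitary `h₁ = 1 + (w − 1)·P` and the commutator bound -/

section HOne

variable {i₀ i₁ : n} (h01 : i₀ ≠ i₁) {χ : n → ℂ} (hχ : ∀ a, χ a = if a = i₀ ∨ a = i₁ then 1 else 0) {P : Matrix n n ℂ}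
  (hP : ∀ a b, P a b = χ a * χ b / 2) {w : ℂ} {h : Matrix n n ℂ} (hh : h = 1 + (w - 1) • P)
include h01 hχ hP hh

/-- `h₁ = 1 + (w−1)P` is unitary for `|w| = 1`: `h₁ᴴh₁ = 1 + (w̄ − 1 + w − 1 + |w − 1|²)P = 1 + (|w|² − 1)P = 1`. [folklore] -/
theorem hOne_mem_unitary (hw : ‖w‖ = 1) : h ∈ unitary (Matrix n n ℂ) := by
  have hPP := (proj_idem_selfAdjoint h01 hχ hP).1
  have hPs : star P = P := by rw [Matrix.star_eq_conjTranspose, (proj_idem_selfAdjoint h01 hχ hP).2]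
  have hww : conj w * w = 1 := by
    rw [Complex.conj_mul', hw]; norm_num
  have hww' : w * conj w = 1 := by rw [mul_comm, hww]
  have hsh : star h = 1 + (conj w - 1) • P := by
    rw [hh, star_add, star_one, star_smul, hPs]
    simp
  have key : ∀ α β : ℂ, α + β + α * β = 0 → (1 + α • P) * (1 + β • P) = 1 := by
    intro α β hαβ
    have e : (1 + α • P) * (1 + β • P) = 1 + (α + β + α * β) • P := by
      simp only [add_mul, mul_add, one_mul, mul_one, smul_mul_assoc, mul_smul_comm, hPP]
      module
    rw [e, hαβ, zero_smul, add_zero]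
  refine Unitary.mem_iff.mpr ⟨?_, ?_⟩
  · rw [hsh, hh]
    exact key _ _ (by linear_combination hww)
  · rw [hsh, hh]
    exact key _ _ (by linear_combination hww')

/-- `‖h₁ − 1‖ ≤ |w − 1|`. [folklore] -/
theorem norm_hOne_sub_one_le : ‖h - 1‖ ≤ ‖w - 1‖ := by
  rw [hh, add_sub_cancel_left]
  refine (norm_smul_le _ _).trans ?_
  have := norm_proj_le_one h01 hχ hP
  exact mul_le_of_le_one_right (norm_nonneg _) this

omit [Fintype n] in
/-- The entries of `h₁`: `(h₁)_{i₁i₀} = (w−1)∕2`, `(h₁)_{i₀i₀} = (h₁)_{i₁i₁}`, row `i₁` and column `i₀` vanish off `{i₀, i₁}`. [folklore] -/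
theorem hOne_entries : h i₁ i₀ = (w - 1) / 2 ∧ h i₀ i₀ = h i₁ i₁ ∧
    (∀ k, k ≠ i₀ → k ≠ i₁ → h i₁ k = 0) ∧ (∀ k, k ≠ i₀ → k ≠ i₁ → h k i₀ = 0) := by
  obtain ⟨p10, p00, p11, prow, pcol⟩ := proj_apply_block hχ hP
  refine ⟨?_, ?_, fun k hk0 hk1 => ?_, fun k hk0 hk1 => ?_⟩
  · rw [hh, Matrix.add_apply, Matrix.smul_apply, p10, Matrix.one_apply_ne h01.symm, smul_eq_mul]; ring
  · rw [hh, Matrix.add_apply, Matrix.add_apply, Matrix.smul_apply, Matrix.smul_apply, p00, p11, Matrix.one_apply_eq, Matrix.one_apply_eq]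
  · rw [hh, Matrix.add_apply, Matrix.smul_apply, prow k hk0 hk1, Matrix.one_apply_ne (Ne.symm hk1), smul_zero, add_zero]
  · rw [hh, Matrix.add_apply, Matrix.smul_apply, pcol k hk0 hk1, Matrix.one_apply_ne hk0, smul_zero, add_zero]

end HOne

omit [Fintype n] in
/-- The entries of `D(z) = diagonal (update 1 i₀ z)`: `(i₀,i₀) ↦ z`, `(i₁,i₁) ↦ 1` (`i₁ ≠ i₀`), row `i₁` and column `i₀` supported on the diagonal. [folklore] -/
theorem phaseMat_entries {i₀ i₁ : n} (h01 : i₀ ≠ i₁) (z : ℂ) :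
    Matrix.diagonal (Function.update (1 : n → ℂ) i₀ z) i₀ i₀ = z ∧ Matrix.diagonal (Function.update (1 : n → ℂ) i₀ z) i₁ i₁ = 1 ∧
    (∀ k, k ≠ i₁ → Matrix.diagonal (Function.update (1 : n → ℂ) i₀ z) i₁ k = 0) ∧
    (∀ k, k ≠ i₀ → Matrix.diagonal (Function.update (1 : n → ℂ) i₀ z) k i₀ = 0) := by
  refine ⟨?_, ?_, fun k hk => ?_, fun k hk => ?_⟩
  · rw [Matrix.diagonal_apply_eq, Function.update_self]
  · rw [Matrix.diagonal_apply_eq, Function.update_of_ne h01.symm, Pi.one_apply]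
  · rw [Matrix.diagonal_apply_ne _ (Ne.symm hk)]
  · rw [Matrix.diagonal_apply_ne _ hk]

end

end Summit.QuantumFields.BalabanUV.T4Continuum.NE7NearFlatSharpHolonomyPrep
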